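import Literature.MathematicalPhysics.QuantumFieldTheory.Balaban1983to89.BlockAveragingFederbushRadius
import Literature.Probability.LatticeModels.ClusterExpansionActivityPaths

/-!
# THE EXACT `SU(N)` RADIUS OF FEDERBUSH'S IMPLICIT AVERAGE (0.10) of [Balaban1987RG1]:
# `δ♯_N = min(1/100, 2 sin(π/N))` — (0.9) on `SU(N)` holds up to `2 sin(π/N)` and fails beyond it

T. Bałaban, *Renormalization group approach to lattice gauge field theories. I*, Comm. Math. Phys. **109** (1987)
249–301 (`Balaban1987RG1`, "B12"), §0 p. 253 — the locus of the construction this file is about (quotations repeated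
from the headers of `BlockAveragingFederbush` / `BlockAveragingFederbushRadius`, whose loci were certified in the audit
cells C-pv26g2-4, C-pv26g3-2, C-ref5-78, C-pv03-48 of the programme that commissioned these files; nothing new is quoted
here):

«The average of the set {U_j} is the element U ∈ Gᶜ such that U_j are in a small neighborhood of U, and it satisfies
the equation Σ_{j=1}^{n} (1/i) log U_j U⁻¹ = 0. (0.10)»  and, among "the properties listed above" on the same page,
«if U_j ∈ G, then M({U_j}) ∈ G also. (0.9)».

## What this file PROVES (nothing printed is asserted; every statement is about the tree's construction)

The module `BlockAveragingFederbush` constructs the solution `X = fedSol W` of (0.10) for families with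
`‖W_j − 1‖ ≤ 1/100`, the group average `fedM δ U = (fedSol (U_j U₀*))* U₀` on matrix families, and the inhabitants
`federbushU : GroupAverage U(N)` (radius `1/100`) and `federbushSU : GroupAverage SU(N)` (radius
`δ_N = min(1/100, 1/(3N))`), proving (0.9) on `SU(N)` — `det X = 1` — under `N·δ ≤ 1/3`.  The module
`BlockAveragingFederbushRadius` exhibits the ROOT PAIR `{1, e^{2πi/N}·1}`: an `SU(N)`-family passing the guard of `fedM δ`
iff `δ > 2 sin(π/N)`, whose mean `e^{iπ/N}·1` has determinant `−1`; it concludes that the largest radius `δ*(N)` below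
which `fedM δ` is `SU(N)`-valued on `SU(N)`-families has ORDER `1/N`, "the constant in `[1/3, 2π]` is not determined
here", and leaves undecided whether (0.9) can fail at the radius `1/100` for `34 ≤ N ≤ 628`.  THIS FILE DETERMINES THE
CONSTANT and decides that question (`N = |n|`, `L²`-operator norm, `log` = the series (21) `MatrixLog.mlog`):

* §1 ADDITIVITY OF `tr log` ON THE CHART (`trace_mlog_mul`): for `‖W − 1‖‖X − 1‖ + ‖W − 1‖ + ‖X − 1‖ < 1`,
  `tr log (W X) = tr log W + tr log X` (though `log (W X) ≠ log W + log X`).  Proof by continuity induction on the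
  segment `(1 + t(W − 1))(1 + t(X − 1))`, `t ∈ [0,1]` (`IsClosed.Icc_subset_of_forall_mem_nhdsWithin`, as in the tree's
  `B7BlockAvgLog.mlog_exp`): `f(t) = tr log (W_tX_t) − tr log W_t − tr log X_t` is continuous (`analyticAt_mlog`), has
  `e^{f(t)} = det (W_tX_t)/(det W_t det X_t) = 1` (Liouville `det e^A = e^{tr A}`, the tree's `det_exp_eq_exp_trace`),
  and `f(0) = 0`.  Consequence (§3, `card_mul_trace_mlog_fedSol`): `|I|·tr log X = −Σ_j tr log W_j` for the solution
  `X` of (0.10), and for `det W_j = 1` families `(det X)^{|I|} = 1` (`det_fedSol_pow_card_eq_one`: the determinant of the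
  implicit mean of an `SL(N,ℂ)`-family of radius `1/100` is an `|I|`-TH ROOT OF UNITY — the root pair realises `−1`).
* §2 THE SHARP UNITARY LEMMA (`trace_mlog_eq_zero_of_norm_lt_two_sin`): for `W ∈ U(N)` with `det W = 1`,
  `‖W − 1‖ ≤ 1/3` and `‖W − 1‖ < 2 sin(π/N)`: `tr log W = 0`.  Proof: `H = −i log W` is Hermitian
  (`ExpMeanLog.star_mlog_eq_neg`); each eigenvalue `θ_l` (Mathlib `IsHermitian.eigenvalues`, `trace_eq_sum_eigenvalues`,
  `eigenvalues_mem_spectrum_real`) has `iθ_l ∈ σ(log W)`, so `e^{iθ_l} ∈ σ(W)` by Mathlib's spectral inclusion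
  `spectrum.exp_mem_exp`, hence `2|sin(θ_l/2)| = |e^{iθ_l} − 1| ≤ ‖W − 1‖ < 2 sin(π/N)` (`spectrum.norm_le_norm_of_mem`,
  `Complex.norm_exp_I_mul_ofReal_sub_one`) and `|θ_l| ≤ ‖log W‖ ≤ 2/3`, whence `|θ_l| < 2π/N`, `|tr log W| < 2π`, and
  `e^{tr log W} = det W = 1` forces `tr log W = 0`.  (The tree's `ExpMeanLog.trace_mlog_eq_zero_of_det_eq_one` is the
  same conclusion under the cruder `N‖W − 1‖ < π`.)
* §3 (0.9) ON `SU(N)` AT THE SHARP RADIUS: `det (fedSol W) = 1` and `fedSol W ∈ SU(N)` for every `SU(N)`-family with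
  `‖W_j − 1‖ ≤ 1/100` and `‖W_j − 1‖ < 2 sin(π/N)` — no hypothesis `N·δ ≤ 1/3`
  (`det_fedSol_eq_one_of_norm_lt_two_sin`, `fedSol_mem_specialUnitaryGroup_of_norm_lt_two_sin`).
* §4 THE EXACT RADIUS: `fedM δ U ∈ SU(N)` for `SU(N)`-families whenever `δ ≤ 1/100` and `δ ≤ 2 sin(π/N)`
  (`fedM_mem_specialUnitaryGroup_of_le_two_sin`); and the DICHOTOMY (`fedM_specialUnitary_valued_iff`): for `N ≥ 2` and
  `δ ≤ 1/100`, `fedM δ` maps every `SU(N)`-family (every arity) into `SU(N)` IF AND ONLY IF `δ ≤ 2 sin(π/N)` — (⇒) by the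
  root pair of `BlockAveragingFederbushRadius`.  At `δ = 1/100` (`fedM_one_div_specialUnitary_valued_iff`, and at group
  level for `federbushU`, `federbushU_specialUnitary_valued_iff`): `SU(N)`-valued on all `SU(N)`-families IFF `N ≤ 628`
  (the numeric threshold `two_mul_sin_pi_div_lt` / `lt_two_mul_sin_pi_div` of that module).  So, in its notation,
  `δ*(N) = δ♯_N := min(1/100, 2 sin(π/N))` exactly (within the constructed range `δ ≤ 1/100`), the constant is `2π`
  (`2 sin(π/N) ~ 2π/N`), and (0.9) does NOT fail at radius `1/100` for any `N ≤ 628`.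
* §5 THE `SU(N)` INHABITANT AT THE EXACT RADIUS (`N ≥ 2`, i.e. `[Nontrivial n]`): `federbushSUSharp : GroupAverage SU(N)`
  with `δ = δ♯_N ≥ δ_N` (`deltaFed_le_deltaSharp`), measurable at every arity (`measurable_fedM_specialUnitary`: `U ↦ fedM δ U ∈ SU(N)`
  is Borel measurable on `SU(N)`-families for every `δ ≤ δ♯_N`), solving (0.10), locally unique, constant
  on constant families, `3δ'`-close to the base point, and equal to `federbushSU` on the latter's guard
  (`federbushSUSharp_measurable`, `_solves`, `_unique`, `_const`, `_dist1_le`, `_eq_federbushSU`); no radius in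
  `(δ♯_N, 1/100]` keeps the construction `SU(N)`-valued (`fedM_not_specialUnitary_valued_of_deltaSharp_lt`).

## What is NOT encoded

* Radii `> 1/100`: the tree's `fedSol` is not constructed there, so nothing is claimed (in particular for `N ≤ 628`
  the exact radius of an extended construction is not determined; `δ♯_N = 1/100` there is the boundary of the
  constructed range, not an obstruction).
* `N = 1`: `SU(1) = {1}` is preserved at every radius while `2 sin π = 0`, so the dichotomy is stated for `N ≥ 2` and
  the inhabitant §5 for `[Nontrivial n]`; the tree's `federbushSU` covers `N = 1`.
* Nothing here is a statement of print: B12 asserts (0.9) for "sufficiently small diameters" without a rate in `N`;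
  the numbers `1/100`, `2 sin(π/N)`, `628` are the FILES'.  Print's operation is on `Gᶜ`-valued families; the `Gᶜ`
  (`SL(N,ℂ)`) reading is touched only by `det_fedSol_pow_card_eq_one` (§1/§3) and by `BlockAveragingFederbushRadius` §4.

Model conventions: `[cite: Balaban1987RG1, (0.9) p.253]` sits on the two verifications of (0.9) for the constructed
average (§3 `fedSol_mem_specialUnitaryGroup_of_norm_lt_two_sin`, §4 `fedM_mem_specialUnitaryGroup_of_le_two_sin`), and
`[cite: Balaban1987RG1, (0.5)–(0.7), (0.9)–(0.10) p.253]` on the inhabitant `federbushSUSharp`, exactly as on the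
tree's `fedSol_mem_specialUnitaryGroup` / `fedM_mem_specialUnitaryGroup` / `federbushSU` which they sharpen; everything
else is `[folklore]` (linear algebra: spectral mapping, Liouville's formula, continuity induction).
-/

noncomputable section

open NormedSpace Metric Set

namespace Literature.MathematicalPhysics.QuantumFieldTheory.Balaban1983to89

namespace FederbushMean

open MatrixLog ExpMeanLog
open Literature.Analysis.Matrix (det_exp_eq_exp_trace)
open Literature.Probability.LatticeModels (eq_zero_of_exp_eq_one_of_norm_lt)
open scoped Matrix.Norms.L2Operator

/-! ## §0 A scalar helper -/

section Scalar

/-- `|2 sin(x/2)| < 2 sin(π/N)` with `|x| ≤ π` and `N ≥ 2` forces `|x| < 2π/N`. [folklore] -/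
theorem abs_lt_of_sin_half_lt {x : ℝ} {N : ℕ} (hN : 2 ≤ N) (hx : |x| ≤ Real.pi)
    (h : ‖2 * Real.sin (x / 2)‖ < 2 * Real.sin (Real.pi / N)) : |x| < 2 * Real.pi / N := by
  have hNr : (2 : ℝ) ≤ N := by exact_mod_cast hN
  have hNpos : (0 : ℝ) < N := by linarith
  rw [Real.norm_eq_abs, abs_mul, abs_of_pos (by norm_num : (0 : ℝ) < 2)] at h
  have h1 : |Real.sin (x / 2)| < Real.sin (Real.pi / N) := by linarith
  have hx2 : |x / 2| ≤ Real.pi / 2 := by rw [abs_div, abs_of_pos (by norm_num : (0 : ℝ) < 2)]; linarith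
  rw [Real.abs_sin_eq_sin_abs_of_abs_le_pi (hx2.trans (by linarith [Real.pi_pos]))] at h1
  have ha : |x / 2| ∈ Icc (-(Real.pi / 2)) (Real.pi / 2) := ⟨by linarith [abs_nonneg (x / 2), Real.pi_pos], hx2⟩
  have hb : Real.pi / N ∈ Icc (-(Real.pi / 2)) (Real.pi / 2) :=
    ⟨by linarith [div_nonneg Real.pi_pos.le hNpos.le, Real.pi_pos],
      div_le_div_of_nonneg_left Real.pi_pos.le (by norm_num) hNr⟩
  have h2 : |x / 2| < Real.pi / N := (Real.strictMonoOn_sin.lt_iff_lt ha hb).1 h1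
  rw [abs_div, abs_of_pos (by norm_num : (0 : ℝ) < 2)] at h2
  rw [lt_div_iff₀ hNpos]
  rw [div_lt_div_iff₀ (by norm_num) hNpos] at h2
  linarith

end Scalar

/-! ## §1 The trace of the series logarithm is additive on the chart -/

section TraceLog

variable {n : Type*} [Fintype n] [DecidableEq n]

/-- `e^{tr log Y} = det Y` on the chart `‖Y − 1‖ < 1` (Liouville's formula `det e^A = e^{tr A}` at `A = log Y`).
[folklore] -/
theorem cexp_trace_mlog {Y : Matrix n n ℂ} (hY : ‖Y - 1‖ < 1) : Complex.exp (mlog Y).trace = Y.det := by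
  rw [Complex.exp_eq_exp_ℂ, ← det_exp_eq_exp_trace, exp_mlog hY]

/-- **ADDITIVITY OF `tr log` ON THE CHART.**  For `‖W − 1‖‖X − 1‖ + ‖W − 1‖ + ‖X − 1‖ < 1` (so that `W`, `X` and
`W X` all lie in the chart `‖· − 1‖ < 1` of the series logarithm (21)):
`tr log (W X) = tr log W + tr log X` — although `log (W X) ≠ log W + log X` for non-commuting `W`, `X`.
Proof: along the segment `W_t = 1 + t(W − 1)`, `X_t = 1 + t(X − 1)`, `t ∈ [0,1]`, the continuous function
`f(t) = tr log (W_t X_t) − tr log W_t − tr log X_t` satisfies `e^{f(t)} = det (W_t X_t)/(det W_t det X_t) = 1` and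
`f(0) = 0`, hence (continuity induction, values in the discrete set `2πiℤ`) `f ≡ 0`. [folklore] -/
theorem trace_mlog_mul {W X : Matrix n n ℂ} (h : ‖W - 1‖ * ‖X - 1‖ + ‖W - 1‖ + ‖X - 1‖ < 1) :
    (mlog (W * X)).trace = (mlog W).trace + (mlog X).trace := by
  have ha0 : 0 ≤ ‖W - 1‖ := norm_nonneg _
  have hb0 : 0 ≤ ‖X - 1‖ := norm_nonneg _
  -- the segment
  let Wt : ℝ → Matrix n n ℂ := fun t => 1 + (t : ℂ) • (W - 1)
  let Xt : ℝ → Matrix n n ℂ := fun t => 1 + (t : ℂ) • (X - 1)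
  have hWt : ∀ t ∈ Icc (0 : ℝ) 1, ‖Wt t - 1‖ ≤ ‖W - 1‖ := by
    intro t ht
    simp only [Wt, add_sub_cancel_left, norm_smul, Complex.norm_real, Real.norm_eq_abs, abs_of_nonneg ht.1]
    exact mul_le_of_le_one_left ha0 ht.2
  have hXt : ∀ t ∈ Icc (0 : ℝ) 1, ‖Xt t - 1‖ ≤ ‖X - 1‖ := by
    intro t ht
    simp only [Xt, add_sub_cancel_left, norm_smul, Complex.norm_real, Real.norm_eq_abs, abs_of_nonneg ht.1]
    exact mul_le_of_le_one_left hb0 ht.2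
  have hW1 : ∀ t ∈ Icc (0 : ℝ) 1, ‖Wt t - 1‖ < 1 := fun t ht => (hWt t ht).trans_lt (by nlinarith)
  have hX1 : ∀ t ∈ Icc (0 : ℝ) 1, ‖Xt t - 1‖ < 1 := fun t ht => (hXt t ht).trans_lt (by nlinarith)
  have hWX1 : ∀ t ∈ Icc (0 : ℝ) 1, ‖Wt t * Xt t - 1‖ < 1 := fun t ht =>
    (norm_mul_sub_one_le (hWt t ht) (hXt t ht)).trans_lt h
  -- the function
  let f : ℝ → ℂ := fun t => (mlog (Wt t * Xt t)).trace - (mlog (Wt t)).trace - (mlog (Xt t)).trace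
  have hf : ∀ t, f t = (mlog (Wt t * Xt t)).trace - (mlog (Wt t)).trace - (mlog (Xt t)).trace := fun _ => rfl
  -- (i) every value on `[0,1]` is a logarithm of `1`
  have hexp : ∀ t ∈ Icc (0 : ℝ) 1, Complex.exp (f t) = 1 := by
    intro t ht
    have hdW : (Wt t).det ≠ 0 := by rw [← cexp_trace_mlog (hW1 t ht)]; exact Complex.exp_ne_zero _
    have hdX : (Xt t).det ≠ 0 := by rw [← cexp_trace_mlog (hX1 t ht)]; exact Complex.exp_ne_zero _
    rw [hf, Complex.exp_sub, Complex.exp_sub, cexp_trace_mlog (hWX1 t ht), cexp_trace_mlog (hW1 t ht),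
      cexp_trace_mlog (hX1 t ht), Matrix.det_mul]
    field_simp
  -- (ii) `f` is continuous at every point of `[0,1]`
  have htr : Continuous fun M : Matrix n n ℂ => M.trace :=
    (Matrix.traceLinearMap n ℂ ℂ).continuous_of_finiteDimensional
  have hcWt : Continuous Wt := continuous_const.add (Complex.continuous_ofReal.smul continuous_const)
  have hcXt : Continuous Xt := continuous_const.add (Complex.continuous_ofReal.smul continuous_const)
  have hcont : ∀ s ∈ Icc (0 : ℝ) 1, ContinuousAt f s := by
    intro s hs
    have h1 : ContinuousAt (fun r : ℝ => (mlog (Wt r * Xt r)).trace) s :=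
      htr.continuousAt.comp' ((MatrixLog.analyticAt_mlog (hWX1 s hs)).continuousAt.comp'
        (f := fun r : ℝ => Wt r * Xt r) (hcWt.mul hcXt).continuousAt)
    have h2 : ContinuousAt (fun r : ℝ => (mlog (Wt r)).trace) s :=
      htr.continuousAt.comp' ((MatrixLog.analyticAt_mlog (hW1 s hs)).continuousAt.comp' (f := Wt) hcWt.continuousAt)
    have h3 : ContinuousAt (fun r : ℝ => (mlog (Xt r)).trace) s :=
      htr.continuousAt.comp' ((MatrixLog.analyticAt_mlog (hX1 s hs)).continuousAt.comp' (f := Xt) hcXt.continuousAt)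
    exact (h1.sub h2).sub h3
  -- (iii) continuity induction: the zero set of `f` contains `[0,1]`
  have hsub : Icc (0 : ℝ) 1 ⊆ f ⁻¹' {0} := by
    refine IsClosed.Icc_subset_of_forall_mem_nhdsWithin ?_ ?_ ?_
    · rw [Set.inter_comm]
      exact ContinuousOn.preimage_isClosed_of_isClosed (fun s hs => (hcont s hs).continuousWithinAt)
        isClosed_Icc isClosed_singleton
    · show f 0 = 0
      rw [hf]
      simp [Wt, Xt]
    · rintro s ⟨hs', hs0, hs1⟩
      have hs : s ∈ Icc (0 : ℝ) 1 := ⟨hs0, hs1.le⟩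
      have hzero : f s = 0 := hs'
      have hball : ball (0 : ℂ) 1 ∈ nhds (f s) := by
        rw [hzero]
        exact ball_mem_nhds _ one_pos
      have hev1 : ∀ᶠ r in nhds s, ‖f r‖ < 1 := by
        filter_upwards [(hcont s hs).eventually_mem hball] with r hr
        rwa [mem_ball_zero_iff] at hr
      have hev2 : ∀ᶠ r in nhdsWithin s (Ioi s), r ∈ Ioo s 1 := Ioo_mem_nhdsGT hs1
      filter_upwards [hev1.filter_mono nhdsWithin_le_nhds, hev2] with r hr1 hr2
      exact eq_zero_of_exp_eq_one_of_norm_lt (hexp r ⟨hs0.trans hr2.1.le, hr2.2.le⟩)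
        (hr1.trans (by linarith [Real.pi_gt_three]))
  have h1 : f 1 = 0 := hsub ⟨zero_le_one, le_rfl⟩
  rw [hf] at h1
  simp only [Wt, Xt, Complex.ofReal_one, one_smul, add_sub_cancel] at h1
  linear_combination h1

end TraceLog

/-! ## §2 The sharp unitary lemma: `tr log W = 0` for `W ∈ SU(N)` with `‖W − 1‖ < 2 sin(π/N)` -/

section UnitaryLog

variable {n : Type*} [Fintype n] [DecidableEq n]

/-- For unitary `W` in the chart `‖W − 1‖ ≤ 1/3`, `H = −i log W` is Hermitian (`(log W)* = −log W`, the tree's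
`ExpMeanLog.star_mlog_eq_neg`). [folklore] -/
theorem isHermitian_negI_smul_mlog {W : Matrix n n ℂ} (hWu : W ∈ Matrix.unitaryGroup n ℂ)
    (hW : ‖W - 1‖ ≤ 1 / 3) : ((-Complex.I) • mlog W).IsHermitian := by
  have hstar := star_mlog_eq_neg hWu hW
  rw [Matrix.star_eq_conjTranspose] at hstar
  show Matrix.conjTranspose ((-Complex.I) • mlog W) = (-Complex.I) • mlog W
  rw [Matrix.conjTranspose_smul, hstar]
  simp

/-- **THE SHARP UNITARY LEMMA.**  For `W ∈ U(N)` with `det W = 1`, `‖W − 1‖ ≤ 1/3` and `‖W − 1‖ < 2 sin(π/N)`: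
`tr log W = 0`.  Proof: `H = −i log W` is Hermitian with eigenvalues `θ_l`; by spectral mapping
(`spectrum.exp_mem_exp`) `e^{iθ_l} ∈ σ(W)`, so `|e^{iθ_l} − 1| = 2|sin(θ_l/2)| ≤ ‖W − 1‖ < 2 sin(π/N)`, and
`|θ_l| ≤ ‖log W‖ ≤ 2/3 < π`, whence `|θ_l| < 2π/N`; therefore `|tr log W| = |Σ_l θ_l| < 2π`, while `e^{tr log W} =
det W = 1`.  The constant `2 sin(π/N)` is attained by `W = e^{2πi/N}·1` (`tr log W = 2πi`, gen-7 root pair).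
[folklore] -/
theorem trace_mlog_eq_zero_of_norm_lt_two_sin {W : Matrix n n ℂ} (hWu : W ∈ Matrix.unitaryGroup n ℂ)
    (hdet : W.det = 1) (hW : ‖W - 1‖ ≤ 1 / 3) (hsin : ‖W - 1‖ < 2 * Real.sin (Real.pi / Fintype.card n)) :
    (mlog W).trace = 0 := by
  rcases isEmpty_or_nonempty n with hn | hn
  · simp [Matrix.trace]
  -- `N ≥ 2` (for `N = 1` the hypothesis `‖W − 1‖ < 2 sin π = 0` is void)
  have hN : 2 ≤ Fintype.card n := by
    by_contra hlt
    have h1 : Fintype.card n = 1 := le_antisymm (by omega) Fintype.card_pos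
    rw [h1, Nat.cast_one, div_one, Real.sin_pi, mul_zero] at hsin
    exact absurd hsin (not_lt.2 (norm_nonneg (W - 1)))
  have hW1 : ‖W - 1‖ < 1 := hW.trans_lt (by norm_num)
  set A := mlog W with hA_def
  set H : Matrix n n ℂ := (-Complex.I) • A with hH_def
  have hH : H.IsHermitian := isHermitian_negI_smul_mlog hWu hW
  have hIH : Complex.I • H = A := by
    rw [hH_def, smul_smul]; simp
  -- norm of `A`
  have hAn : ‖A‖ ≤ 2 / 3 := (norm_mlog_le_two_mul (hW.trans (by norm_num))).trans (by linarith)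
  -- each eigenvalue `θ` of `H`: `iθ ∈ σ(A)`
  have hθ : ∀ i, |hH.eigenvalues i| < 2 * Real.pi / Fintype.card n := by
    intro i
    set θ := hH.eigenvalues i with hθ_def
    have h1 : ((θ : ℝ) : ℂ) ∈ spectrum ℂ H := by
      have := spectrum.algebraMap_mem ℂ (hH.eigenvalues_mem_spectrum_real i)
      rwa [Complex.coe_algebraMap] at this
    have h2 : Complex.I * (θ : ℂ) ∈ spectrum ℂ A := by
      have h := (spectrum.smul_mem_smul_iff (a := H) (s := ((θ : ℝ) : ℂ))
        (r := Units.mk0 Complex.I Complex.I_ne_zero)).2 h1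
      rwa [Units.smul_def, Units.smul_def, Units.val_mk0, smul_eq_mul, hIH] at h
    -- `|θ| ≤ ‖A‖`
    have h3 : |θ| ≤ 2 / 3 := by
      have := spectrum.norm_le_norm_of_mem h2
      rw [norm_mul, Complex.norm_I, one_mul, Complex.norm_real, Real.norm_eq_abs] at this
      exact this.trans hAn
    -- `e^{iθ} − 1 ∈ σ(W − 1)`
    have h4 : Complex.exp (Complex.I * θ) ∈ spectrum ℂ W := by
      have := spectrum.exp_mem_exp A h2
      rwa [hA_def, exp_mlog hW1, ← Complex.exp_eq_exp_ℂ] at this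
    have h5 : Complex.exp (Complex.I * θ) - 1 ∈ spectrum ℂ (W - 1) := by
      have := Set.sub_mem_sub h4 (Set.mem_singleton (1 : ℂ))
      rwa [spectrum.sub_singleton_eq, map_one] at this
    have h6 : ‖2 * Real.sin (θ / 2)‖ < 2 * Real.sin (Real.pi / Fintype.card n) := by
      rw [← Complex.norm_exp_I_mul_ofReal_sub_one]
      exact (spectrum.norm_le_norm_of_mem h5).trans_lt hsin
    exact abs_lt_of_sin_half_lt hN (h3.trans (by linarith [Real.pi_gt_three])) h6
  -- the trace
  have htr : A.trace = Complex.I * ∑ i, (hH.eigenvalues i : ℂ) := by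
    rw [← hIH, Matrix.trace_smul, hH.trace_eq_sum_eigenvalues, smul_eq_mul]
    rfl
  have hbd : ‖A.trace‖ < 2 * Real.pi := by
    rw [htr, norm_mul, Complex.norm_I, one_mul, ← Complex.ofReal_sum, Complex.norm_real, Real.norm_eq_abs]
    have hc : (0 : ℝ) < Fintype.card n := Nat.cast_pos.mpr Fintype.card_pos
    calc |∑ i, hH.eigenvalues i| ≤ ∑ i, |hH.eigenvalues i| := Finset.abs_sum_le_sum_abs _ _
      _ < ∑ _i : n, 2 * Real.pi / Fintype.card n := Finset.sum_lt_sum_of_nonempty Finset.univ_nonempty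
          fun i _ => hθ i
      _ = 2 * Real.pi := by
          rw [Finset.sum_const, Finset.card_univ, nsmul_eq_mul]; field_simp
  have hexp : Complex.exp A.trace = 1 := by rw [hA_def, cexp_trace_mlog hW1, hdet]
  exact eq_zero_of_exp_eq_one_of_norm_lt hexp hbd

end UnitaryLog

/-! ## §3 (0.9) on `SU(N)` at the sharp radius: `det X = 1` for the solution `X` of (0.10) -/

section ImplicitMean

variable {n : Type*} [Fintype n] [DecidableEq n]
variable {ι : Type*} [Fintype ι] [Nonempty ι]

/-- **The trace identity behind (0.9).**  For any family in the domain of `fedSol` (`‖W_j − 1‖ ≤ 1/100`, any complete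
normed algebra would do; here matrices): `|I| · tr log X = −Σ_j tr log W_j` for the solution `X = fedSol W` of (0.10)
`Σ_j log (W_j X) = 0` — by §1, `tr log (W_j X) = tr log W_j + tr log X` for every `j`. [folklore] -/
theorem card_mul_trace_mlog_fedSol {W : ι → Matrix n n ℂ} (hW : ∀ j, ‖W j - 1‖ ≤ 1 / 100) :
    (Fintype.card ι : ℂ) * (mlog (fedSol W)).trace = -∑ j, (mlog (W j)).trace := by
  have hX : ‖fedSol W - 1‖ ≤ 3 / 100 := (fedSol_spec hW).1
  have hadd : ∀ j, (mlog (W j * fedSol W)).trace = (mlog (W j)).trace + (mlog (fedSol W)).trace := by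
    intro j
    refine trace_mlog_mul ?_
    have h0 : 0 ≤ ‖W j - 1‖ := norm_nonneg _
    nlinarith [hW j, norm_nonneg (fedSol W - 1)]
  have hsum : ∑ j, (mlog (W j * fedSol W)).trace = 0 := by
    rw [← Matrix.trace_sum, sum_mlog_mul_fedSol hW, Matrix.trace_zero]
  simp only [hadd, Finset.sum_add_distrib, Finset.sum_const, Finset.card_univ, nsmul_eq_mul] at hsum
  linear_combination hsum

/-- **For `det W_j = 1` families (`Gᶜ = SL(N, ℂ)` reading of (0.10), radius `1/100`, NO `N`-dependence) the determinant
of the implicit mean is an `|I|`-th ROOT OF UNITY**: `(det X)^{|I|} = e^{|I| tr log X} = Π_j e^{−tr log W_j} = 1`.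
(The gen-7 root pair realises `det X = −1` with `|I| = 2`.) [folklore] -/
theorem det_fedSol_pow_card_eq_one {W : ι → Matrix n n ℂ} (hWd : ∀ j, (W j).det = 1)
    (hW : ∀ j, ‖W j - 1‖ ≤ 1 / 100) : (fedSol W).det ^ Fintype.card ι = 1 := by
  have hX : ‖fedSol W - 1‖ ≤ 3 / 100 := (fedSol_spec hW).1
  rw [← cexp_trace_mlog (hX.trans_lt (by norm_num)), ← Complex.exp_nat_mul, card_mul_trace_mlog_fedSol hW,
    Complex.exp_neg, Complex.exp_sum, Finset.prod_eq_one (fun j _ => ?_), inv_one]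
  rw [cexp_trace_mlog ((hW j).trans_lt (by norm_num)), hWd j]

/-- **(0.9) on `SU(N)` AT THE SHARP RADIUS: `det X = 1`** for the solution `X = fedSol W` of (0.10), for every
`SU(N)`-family with `‖W_j − 1‖ ≤ 1/100` and `‖W_j − 1‖ < 2 sin(π/N)` — NO hypothesis `N·δ ≤ 1/3` (the tree's
`det_fedSol_eq_one`): each `tr log W_j = 0` by the sharp unitary lemma (§2), so `|I| tr log X = 0` (§3 trace identity)
and `det X = e^{tr log X} = 1`. [folklore] -/
theorem det_fedSol_eq_one_of_norm_lt_two_sin {W : ι → Matrix n n ℂ}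
    (hWs : ∀ j, W j ∈ Matrix.specialUnitaryGroup n ℂ) (hW : ∀ j, ‖W j - 1‖ ≤ 1 / 100)
    (hsin : ∀ j, ‖W j - 1‖ < 2 * Real.sin (Real.pi / Fintype.card n)) : (fedSol W).det = 1 := by
  have hX : ‖fedSol W - 1‖ ≤ 3 / 100 := (fedSol_spec hW).1
  have h0 : ∀ j, (mlog (W j)).trace = 0 := fun j =>
    trace_mlog_eq_zero_of_norm_lt_two_sin (Matrix.mem_specialUnitaryGroup_iff.1 (hWs j)).1
      (Matrix.mem_specialUnitaryGroup_iff.1 (hWs j)).2 ((hW j).trans (by norm_num)) (hsin j)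
  have h := card_mul_trace_mlog_fedSol hW
  simp only [h0, Finset.sum_const_zero, neg_zero, mul_eq_zero, Nat.cast_eq_zero, Fintype.card_ne_zero,
    false_or] at h
  rw [← cexp_trace_mlog (hX.trans_lt (by norm_num)), h, Complex.exp_zero]

/-- **(0.9) on `SU(N)` at the sharp radius**: the solution of (0.10) for an `SU(N)`-family with `‖W_j − 1‖ ≤ 1/100`,
`‖W_j − 1‖ < 2 sin(π/N)` lies in `SU(N)` (print's «if U_j ∈ G, then M({U_j}) ∈ G also» for `G = SU(N)`, verified for
the tree's construction on this domain). [cite: Balaban1987RG1, (0.9) p.253] -/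
theorem fedSol_mem_specialUnitaryGroup_of_norm_lt_two_sin {W : ι → Matrix n n ℂ}
    (hWs : ∀ j, W j ∈ Matrix.specialUnitaryGroup n ℂ) (hW : ∀ j, ‖W j - 1‖ ≤ 1 / 100)
    (hsin : ∀ j, ‖W j - 1‖ < 2 * Real.sin (Real.pi / Fintype.card n)) :
    fedSol W ∈ Matrix.specialUnitaryGroup n ℂ :=
  Matrix.mem_specialUnitaryGroup_iff.2
    ⟨fedSol_mem_unitaryGroup (fun j => (Matrix.mem_specialUnitaryGroup_iff.1 (hWs j)).1) hW,
      det_fedSol_eq_one_of_norm_lt_two_sin hWs hW hsin⟩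

end ImplicitMean

/-! ## §4 The exact `SU(N)` radius of Federbush's implicit mean `fedM δ` -/

section MeanSharp

variable {n : Type*} [Fintype n] [DecidableEq n]
variable {m : ℕ} {δ : ℝ} {U : Fin (m + 1) → Matrix n n ℂ}

/-- **`M U ∈ SU(N)` for a special unitary family whenever `δ ≤ 1/100` AND `δ ≤ 2 sin(π/N)`** (on and off the guard) —
the `N`-dependence `δ ≤ 1/(3N)` of the tree's `fedM_mem_specialUnitaryGroup` improved to the sharp `2 sin(π/N)`
(`≥ 4/N`); print's (0.9) for `G = SU(N)`, verified for the tree's construction on this domain.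
[cite: Balaban1987RG1, (0.9) p.253] -/
theorem fedM_mem_specialUnitaryGroup_of_le_two_sin (hU : ∀ j, U j ∈ Matrix.specialUnitaryGroup n ℂ)
    (hδ : δ ≤ 1 / 100) (hδs : δ ≤ 2 * Real.sin (Real.pi / Fintype.card n)) :
    fedM δ U ∈ Matrix.specialUnitaryGroup n ℂ := by
  by_cases h : ∀ i k, ‖U i * star (U k) - 1‖ < δ
  · rw [fedM_of_small h]
    exact mul_mem (star_mem_SU (fedSol_mem_specialUnitaryGroup_of_norm_lt_two_sin
      (rel_mem_specialUnitaryGroup hU 0) (rel_small h hδ 0) fun j => (h j 0).trans_le hδs)) (hU 0)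
  · rw [fedM_of_not_small h]; exact hU 0

/-- **THE EXACT RADIUS (dichotomy).**  For `N ≥ 2` and any `δ ≤ 1/100`: `fedM δ` maps EVERY `SU(N)`-family (every
arity) into `SU(N)` if and only if `δ ≤ 2 sin(π/N)`.  (⇐) is `fedM_mem_specialUnitaryGroup_of_le_two_sin`; (⇒) is the
gen-7 root pair `{1, e^{2πi/N}·1}`, an `SU(N)`-family passing the guard at every `δ > 2 sin(π/N)` whose implicit mean
`e^{iπ/N}·1` has determinant `−1` (`fedM_rootPair_not_mem_specialUnitaryGroup`).  For `N = 1` the statement is false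
as typed (`SU(1) = {1}` is preserved at every radius while `2 sin π = 0`), whence `2 ≤ N`. [folklore] -/
theorem fedM_specialUnitary_valued_iff [Nonempty n] (hN : 2 ≤ Fintype.card n) (hδ : δ ≤ 1 / 100) :
    (∀ (m : ℕ) (U : Fin (m + 1) → Matrix n n ℂ), (∀ j, U j ∈ Matrix.specialUnitaryGroup n ℂ) →
        fedM δ U ∈ Matrix.specialUnitaryGroup n ℂ) ↔ δ ≤ 2 * Real.sin (Real.pi / Fintype.card n) := by
  refine ⟨fun h => ?_, fun hδs m U hU => fedM_mem_specialUnitaryGroup_of_le_two_sin hU hδ hδs⟩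
  by_contra hlt
  rw [not_le] at hlt
  exact fedM_rootPair_not_mem_specialUnitaryGroup hN (hlt.le.trans hδ) hlt
    (h 1 (rootPair n) rootPair_mem_specialUnitaryGroup)

/-- **THE EXACT RADIUS at `δ = 1/100`** (the radius of the lineage's `U(N)`-inhabitant `federbushU`): `fedM (1/100)` is
`SU(N)`-valued on all `SU(N)`-families if and only if `N ≤ 628` (`N ≥ 2`; by §2b of the gen-7 module,
`2 sin(π/N) > 1/100 ⇔ N ≤ 628`). [folklore] -/
theorem fedM_one_div_specialUnitary_valued_iff [Nonempty n] (hN : 2 ≤ Fintype.card n) :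
    (∀ (m : ℕ) (U : Fin (m + 1) → Matrix n n ℂ), (∀ j, U j ∈ Matrix.specialUnitaryGroup n ℂ) →
        fedM (1 / 100) U ∈ Matrix.specialUnitaryGroup n ℂ) ↔ Fintype.card n ≤ 628 := by
  rw [fedM_specialUnitary_valued_iff hN le_rfl]
  constructor
  · intro h
    by_contra hlt
    rw [not_le] at hlt
    exact absurd h (not_le.2 (two_mul_sin_pi_div_lt (N := Fintype.card n) (by omega)))
  · intro h
    exact (lt_two_mul_sin_pi_div hN h).le

/-- **THE SAME AT GROUP LEVEL for `federbushU : GroupAverage U(N)`** (radius `1/100`): its average of every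
`SU(N)`-valued `U(N)`-family is in `SU(N)` if and only if `N ≤ 628` (`N ≥ 2`) — the converse half of the gen-7
`federbushU_not_specialUnitary_valued` (`N ≥ 629`). [folklore] -/
theorem federbushU_specialUnitary_valued_iff [Nonempty n] (hN : 2 ≤ Fintype.card n) :
    (∀ (m : ℕ) (U : Fin (m + 1) → Matrix.unitaryGroup n ℂ),
        (∀ j, ((U j : Matrix.unitaryGroup n ℂ) : Matrix n n ℂ) ∈ Matrix.specialUnitaryGroup n ℂ) →
        (((federbushU (n := n)).M U : Matrix.unitaryGroup n ℂ) : Matrix n n ℂ) ∈ Matrix.specialUnitaryGroup n ℂ) ↔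
      Fintype.card n ≤ 628 := by
  constructor
  · intro h
    by_contra hlt
    rw [not_le] at hlt
    exact federbushU_rootPairU_not_mem (by omega) (h 1 (rootPairU n) rootPairU_mem_specialUnitaryGroup)
  · intro h m U hU
    show fedM (1 / 100) (fun j => ((U j : Matrix.unitaryGroup n ℂ) : Matrix n n ℂ)) ∈ _
    exact fedM_mem_specialUnitaryGroup_of_le_two_sin hU le_rfl (lt_two_mul_sin_pi_div hN h).le

end MeanSharp

/-! ## §5 The `SU(N)` inhabitant at the exact radius `δ♯_N = min(1/100, 2 sin(π/N))` -/

section SharpInhabitant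

variable {n : Type*} [Fintype n] [DecidableEq n]

/-- **The exact radius for `SU(N)`**: `δ♯_N = min(1/100, 2 sin(π/N))` (`= 1/100` for `N ≤ 628`, `= 2 sin(π/N)` for
`N ≥ 629`; compare the tree's `deltaFed = min(1/100, 1/(3N))`). [folklore] -/
def deltaSharp (n : Type*) [Fintype n] : ℝ := min (1 / 100) (2 * Real.sin (Real.pi / Fintype.card n))

omit [DecidableEq n] in
/-- `δ♯_N ≤ 1/100`. [folklore] -/
theorem deltaSharp_le : deltaSharp n ≤ 1 / 100 := min_le_left _ _

omit [DecidableEq n] in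
/-- `δ♯_N ≤ 2 sin(π/N)`. [folklore] -/
theorem deltaSharp_le_two_sin : deltaSharp n ≤ 2 * Real.sin (Real.pi / Fintype.card n) := min_le_right _ _

omit [DecidableEq n] in
/-- `0 < δ♯_N` for `N ≥ 2`. [folklore] -/
theorem deltaSharp_pos [Nontrivial n] : 0 < deltaSharp n := by
  have hN : (2 : ℝ) ≤ Fintype.card n := by exact_mod_cast Fintype.one_lt_card
  have hNpos : (0 : ℝ) < Fintype.card n := by linarith
  refine lt_min (by norm_num) (mul_pos two_pos (Real.sin_pos_of_pos_of_lt_pi (by positivity) ?_))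
  rw [div_lt_iff₀ hNpos]
  nlinarith [Real.pi_pos]

omit [DecidableEq n] in
/-- `δ_N ≤ δ♯_N` (`N ≥ 2`): the exact radius improves the tree's, since `1/(3N) < 4/N ≤ 2 sin(π/N)` (Jordan).
[folklore] -/
theorem deltaFed_le_deltaSharp [Nontrivial n] : deltaFed n ≤ deltaSharp n := by
  refine le_min deltaFed_le ?_
  have hN : (2 : ℝ) ≤ Fintype.card n := by exact_mod_cast Fintype.one_lt_card
  have hNpos : (0 : ℝ) < Fintype.card n := by linarith
  have hx0 : 0 ≤ Real.pi / Fintype.card n := by positivity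
  have hx1 : Real.pi / Fintype.card n ≤ Real.pi / 2 := div_le_div_of_nonneg_left Real.pi_pos.le (by norm_num) hN
  have hJ := Real.mul_le_sin hx0 hx1
  have h2 : 2 / Real.pi * (Real.pi / Fintype.card n) = 2 / Fintype.card n := by field_simp
  rw [h2] at hJ
  have hinv : 0 ≤ 1 / (Fintype.card n : ℝ) := by positivity
  calc deltaFed n ≤ 1 / (3 * Fintype.card n) := min_le_right _ _
    _ = (1 / 3) * (1 / Fintype.card n) := by ring
    _ ≤ 4 * (1 / Fintype.card n) := by nlinarith
    _ = 2 * (2 / Fintype.card n) := by ring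
    _ ≤ 2 * Real.sin (Real.pi / Fintype.card n) := by linarith

/-- **THE RADIUS `δ♯_N` CANNOT BE ENLARGED within the construction** (`N ≥ 2`): at every `δ` with `δ♯_N < δ ≤ 1/100` the
root pair is an `SU(N)`-family inside the guard of `fedM δ` whose mean is outside `SU(N)`. [folklore] -/
theorem fedM_not_specialUnitary_valued_of_deltaSharp_lt [Nontrivial n] {δ : ℝ} (h : deltaSharp n < δ)
    (hδ : δ ≤ 1 / 100) :
    ∃ U : Fin 2 → Matrix n n ℂ, (∀ j, U j ∈ Matrix.specialUnitaryGroup n ℂ) ∧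
      (∀ i k, ‖U i * star (U k) - 1‖ < δ) ∧ fedM δ U ∉ Matrix.specialUnitaryGroup n ℂ := by
  have hs : 2 * Real.sin (Real.pi / Fintype.card n) < δ := by
    rcases min_lt_iff.1 h with h1 | h1
    · exact absurd hδ (not_le.2 h1)
    · exact h1
  exact ⟨rootPair n, rootPair_mem_specialUnitaryGroup, rootPair_small_iff.2 hs,
    fedM_rootPair_not_mem_specialUnitaryGroup Fintype.one_lt_card (hs.le.trans hδ) hs⟩

variable {m : ℕ}

/-- **Federbush's group average on `SU(N)`-families at the exact radius `δ♯_N`** (`N ≥ 2`), `SU(N)`-valued by §4.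
[folklore] -/
def fedMSUSharp (U : Fin (m + 1) → Matrix.specialUnitaryGroup n ℂ) : Matrix.specialUnitaryGroup n ℂ :=
  ⟨fedM (deltaSharp n) (fun j => (U j : Matrix n n ℂ)),
    fedM_mem_specialUnitaryGroup_of_le_two_sin (fun j => (U j).2) deltaSharp_le deltaSharp_le_two_sin⟩

/-- The matrix of `fedMSUSharp U`. [folklore] -/
theorem coe_fedMSUSharp (U : Fin (m + 1) → Matrix.specialUnitaryGroup n ℂ) :
    ((fedMSUSharp U : Matrix.specialUnitaryGroup n ℂ) : Matrix n n ℂ) =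
      fedM (deltaSharp n) (fun j => (U j : Matrix n n ℂ)) :=
  rfl

/-- **MEASURABILITY OF THE `SU(N)`-VALUED GROUP AVERAGE AT EVERY RADIUS `δ ≤ min(1/100, 2 sin(π/N))` and every
arity**: `U ↦ fedM δ U ∈ SU(N)` is Borel measurable on `SU(N)`-families — the guard is open, on it the map is continuous
(`fedSol` is Lipschitz on `1/100`-small families, the tree's `continuousOn_fedSol`), off it it is the continuous
`U ↦ U₀` (the piecewise argument of the tree's `measurable_fedMSU`, which is the radius `δ_N`). [folklore] -/
theorem measurable_fedM_specialUnitary {δ : ℝ} (hδ : δ ≤ 1 / 100)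
    (hδs : δ ≤ 2 * Real.sin (Real.pi / Fintype.card n)) (m : ℕ) :
    Measurable fun U : Fin (m + 1) → Matrix.specialUnitaryGroup n ℂ =>
      (⟨fedM δ (fun j => (U j : Matrix n n ℂ)),
        fedM_mem_specialUnitaryGroup_of_le_two_sin (fun j => (U j).2) hδ hδs⟩ : Matrix.specialUnitaryGroup n ℂ) := by
  set F : (Fin (m + 1) → Matrix.specialUnitaryGroup n ℂ) → Matrix.specialUnitaryGroup n ℂ := fun U =>
    ⟨fedM δ (fun j => (U j : Matrix n n ℂ)),
      fedM_mem_specialUnitaryGroup_of_le_two_sin (fun j => (U j).2) hδ hδs⟩ with hF_def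
  set s : Set (Fin (m + 1) → Matrix.specialUnitaryGroup n ℂ) :=
    {U | ∀ i k, ‖(U i : Matrix n n ℂ) * star (U k : Matrix n n ℂ) - 1‖ < δ} with hs_def
  have hcoe : ∀ i, Continuous fun U : Fin (m + 1) → Matrix.specialUnitaryGroup n ℂ => (U i : Matrix n n ℂ) :=
    fun i => continuous_subtype_val.comp (continuous_apply i)
  have hs_open : IsOpen s := by
    rw [hs_def, Set.setOf_forall]
    refine isOpen_iInter_of_finite fun i => ?_
    rw [Set.setOf_forall]
    exact isOpen_iInter_of_finite fun k =>
      isOpen_lt (((hcoe i).mul (hcoe k).star).sub continuous_const).norm continuous_const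
  have hmaps : Set.MapsTo (fun U : Fin (m + 1) → Matrix.specialUnitaryGroup n ℂ =>
      rel (fun j => (U j : Matrix n n ℂ)) 0) s (smallFamilies (Fin (m + 1)) (Matrix n n ℂ) (1 / 100)) :=
    fun U hU j => (hU j 0).trans_le hδ
  have hcont : ContinuousOn F s := by
    refine Topology.IsInducing.subtypeVal.continuousOn_iff.2 ?_
    have h1 : ContinuousOn (fun U : Fin (m + 1) → Matrix.specialUnitaryGroup n ℂ =>
        star (fedSol (rel (fun j => (U j : Matrix n n ℂ)) 0)) * (U 0 : Matrix n n ℂ)) s :=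
      (continuous_star.comp_continuousOn (continuousOn_fedSol.comp
        (continuous_pi fun j => (hcoe j).mul (hcoe 0).star).continuousOn hmaps)).mul (hcoe 0).continuousOn
    exact h1.congr fun U hU => fedM_of_small hU
  have hcont' : ContinuousOn F sᶜ :=
    (continuous_apply 0).continuousOn.congr fun U hU => Subtype.ext (fedM_of_not_small hU)
  have hpw := ContinuousOn.measurable_piecewise hcont hcont' hs_open.measurableSet
  rwa [Set.piecewise_same] at hpw

variable [Nontrivial n]

/-- **THE `SU(N)` INHABITANT OF `GroupAverage` AT THE EXACT RADIUS `δ♯_N = min(1/100, 2 sin(π/N))`** (`N ≥ 2`), with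
(0.5), (0.6) two-sided and (0.7) proved on `δ♯_N`-small families exactly as for the tree's `federbushSU`
(radius `δ_N = min(1/100, 1/(3N)) ≤ δ♯_N`); by `fedM_not_specialUnitary_valued_of_deltaSharp_lt` no larger radius
`≤ 1/100` keeps this construction `SU(N)`-valued. [cite: Balaban1987RG1, (0.5)–(0.7), (0.9)–(0.10) p.253] -/
def federbushSUSharp : GroupAverage (Matrix.specialUnitaryGroup n ℂ) where
  δ := deltaSharp n
  δ_pos := deltaSharp_pos
  M := fun U => fedMSUSharp U
  inv := fun U hU => by
    apply Subtype.ext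
    show fedM (deltaSharp n) (fun j => star (U j : Matrix n n ℂ)) =
      star (fedM (deltaSharp n) fun j => (U j : Matrix n n ℂ))
    exact fedM_star (fun j => (U j).2.1) deltaSharp_le ((familySmall_SU_iff U).1 hU)
  equivariant := fun U hU u v => by
    apply Subtype.ext
    show fedM (deltaSharp n) (fun j => (u : Matrix n n ℂ) * (U j : Matrix n n ℂ) * (v : Matrix n n ℂ))
      = (u : Matrix n n ℂ) * fedM (deltaSharp n) (fun j => (U j : Matrix n n ℂ)) * (v : Matrix n n ℂ)
    exact fedM_conj (fun j => (U j).2.1) deltaSharp_le ((familySmall_SU_iff U).1 hU) u.2.1 v.2.1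
  perm := fun U hU σ => by
    apply Subtype.ext
    show fedM (deltaSharp n) ((fun j => (U j : Matrix n n ℂ)) ∘ σ) = fedM (deltaSharp n) (fun j => (U j : Matrix n n ℂ))
    exact fedM_perm (fun j => (U j).2.1) deltaSharp_le ((familySmall_SU_iff U).1 hU) σ

/-- The radius of `federbushSUSharp` is `δ♯_N`. [folklore] -/
theorem federbushSUSharp_δ : (federbushSUSharp (n := n)).δ = deltaSharp n := rfl

/-- **`federbushSUSharp.M` is measurable at every arity.** [folklore] -/
theorem federbushSUSharp_measurable : ∀ m : ℕ,
    Measurable fun U : Fin (m + 1) → Matrix.specialUnitaryGroup n ℂ => (federbushSUSharp (n := n)).M U :=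
  fun m => measurable_fedM_specialUnitary deltaSharp_le deltaSharp_le_two_sin m

/-- **`federbushSUSharp` SOLVES (0.10)**: `Σ_j log (U_j · (M U)⁻¹) = 0` on every `δ♯_N`-small `SU(N)`-family.
[folklore] -/
theorem federbushSUSharp_solves {U : Fin (m + 1) → Matrix.specialUnitaryGroup n ℂ}
    (hU : FamilySmall (federbushSUSharp (n := n)).δ U) :
    ∑ j, mlog ((U j : Matrix n n ℂ) * (((federbushSUSharp (n := n)).M U)⁻¹ : Matrix.specialUnitaryGroup n ℂ)) = 0 :=
  sum_mlog_mul_star_fedM deltaSharp_le ((familySmall_SU_iff U).1 hU)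

/-- **LOCAL UNIQUENESS**: on a `δ♯_N`-small family, any `M' ∈ SU(N)` with `dist1 (M' U₀⁻¹) ≤ 2/25` solving (0.10) is
`federbushSUSharp.M U`. [folklore] -/
theorem federbushSUSharp_unique {U : Fin (m + 1) → Matrix.specialUnitaryGroup n ℂ}
    (hU : FamilySmall (federbushSUSharp (n := n)).δ U) {M' : Matrix.specialUnitaryGroup n ℂ}
    (hd : dist1 (M' * (U 0)⁻¹) ≤ 2 / 25)
    (hsol : ∑ j, mlog ((U j : Matrix n n ℂ) * ((M'⁻¹ : Matrix.specialUnitaryGroup n ℂ) : Matrix n n ℂ)) = 0) :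
    M' = (federbushSUSharp (n := n)).M U :=
  Subtype.ext (fedM_unique (fun j => (U j).2.1) deltaSharp_le ((familySmall_SU_iff U).1 hU) hd hsol)

/-- **The average of a constant family is that element.** [folklore] -/
theorem federbushSUSharp_const (V : Matrix.specialUnitaryGroup n ℂ) :
    (federbushSUSharp (n := n)).M (fun _ : Fin (m + 1) => V) = V :=
  Subtype.ext (fedM_const deltaSharp_pos deltaSharp_le V.2.1)

/-- **The average is `3δ'`-close to the base point** when the family is `δ'`-close to it (`δ' ≤ 1/100`, on the guard).
[folklore] -/
theorem federbushSUSharp_dist1_le {U : Fin (m + 1) → Matrix.specialUnitaryGroup n ℂ}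
    (hU : FamilySmall (federbushSUSharp (n := n)).δ U) {δ' : ℝ} (hδ' : δ' ≤ 1 / 100)
    (h' : ∀ j, dist1 (U j * (U 0)⁻¹) ≤ δ') : dist1 ((federbushSUSharp (n := n)).M U * (U 0)⁻¹) ≤ 3 * δ' :=
  norm_fedM_mul_star_sub_one_le_of_le (fun j => (U j).2.1) ((familySmall_SU_iff U).1 hU) hδ' h'

/-- **The sharp inhabitant agrees with the tree's `federbushSU` on the latter's (smaller) guard**: both are
`(fedSol (U_j U₀*))* U₀` there. [folklore] -/
theorem federbushSUSharp_eq_federbushSU {U : Fin (m + 1) → Matrix.specialUnitaryGroup n ℂ}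
    (hU : FamilySmall (federbushSU (n := n)).δ U) :
    (federbushSUSharp (n := n)).M U = (federbushSU (n := n)).M U := by
  apply Subtype.ext
  show fedM (deltaSharp n) (fun j => (U j : Matrix n n ℂ)) = fedM (deltaFed n) (fun j => (U j : Matrix n n ℂ))
  have h1 : ∀ i k, ‖(U i : Matrix n n ℂ) * star (U k : Matrix n n ℂ) - 1‖ < deltaFed n := (familySmall_SU_iff U).1 hU
  have h2 : ∀ i k, ‖(U i : Matrix n n ℂ) * star (U k : Matrix n n ℂ) - 1‖ < deltaSharp n :=
    fun i k => (h1 i k).trans_le deltaFed_le_deltaSharp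
  rw [fedM_of_small h1, fedM_of_small h2]

end SharpInhabitant

end FederbushMean

end Literature.MathematicalPhysics.QuantumFieldTheory.Balaban1983to89
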